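import Literature.Topology.PlanarFoliations.ChainLimit
import HarnessLib

/-!
# The curves of a strictly decreasing chain of compact leaves approach the frontier of the limit

Topic: Topology / PlanarFoliations, sequel to `ChainLimit.lean`. For compact leaves `K n` with
strictly decreasing discs and limit set `Dlim`, **the curves `ι(K n)` converge to the frontier of
the limit set**: for every `ε > 0`, eventually every point of `ι(K n)` is within `ε` of
`frontier Dlim` (`eventually_forall_infDist_lt`). Indeed a limit point of points of the curves
`K n`, `n → ∞`, lies in every disc, hence in `Dlim`, and not in its interior (the curves miss
`Dlim`), hence on the frontier. Also: the later curves lie in each disc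
(`image_leaf_subset_discLeaf_of_le`). Used to place the curves inside the stars and flow boxes
around the frontier graph (the hugging step).

All statements are [folklore].
-/

noncomputable section

open Set Filter Function
open _root_.Topology
open Literature.Topology.FourManifolds Literature.Topology.FourManifolds.Foliation Literature.Topology.PlaneTopology

namespace Literature.Topology.PlanarFoliations

variable {X : Type*} [TopologicalSpace X] [T2Space X] [SecondCountableTopology X] {F : Foliation ℝ X} {ι : X → ℂ}
variable (hbi : IsBiOriented F) (hι : IsOpenEmbedding ι) {K : ℕ → X} (hK : ∀ n, IsCompact (F.leaf (K n)))
  (hdec : ∀ n, discLeaf F ι (K (n + 1)) ⊂ discLeaf F ι (K n))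

include hdec in
omit [T2Space X] [SecondCountableTopology X] in
/-- **Later curves lie in earlier discs.** [folklore] -/
theorem image_leaf_subset_discLeaf_of_le {N n : ℕ} (h : N ≤ n) : ι '' F.leaf (K n) ⊆ discLeaf F ι (K N) :=
  subset_union_left.trans (discLeaf_antitone hdec h)

include hbi hι hK hdec in
/-- **A limit point of points of the curves `K n`, `n → ∞`, is a frontier point of the limit set.**
[folklore] -/
theorem mem_frontier_Dlim_of_clusterPt {z : ℂ} (hz : ∀ N, z ∈ closure (⋃ n ≥ N, ι '' F.leaf (K n))) : z ∈ frontier (Dlim ι F K) := by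
  -- in every disc
  have hzD : z ∈ Dlim ι F K := by
    refine mem_iInter.2 fun N ↦ (isClosed_discLeaf hbi hι (hK N)).closure_subset (closure_mono ?_ (hz N))
    exact iUnion₂_subset fun n hn ↦ image_leaf_subset_discLeaf_of_le hdec hn
  refine ⟨subset_closure hzD, fun hzi ↦ ?_⟩
  -- not interior: the curves miss the limit set
  obtain ⟨w, hw, hwU⟩ := mem_closure_iff_nhds.1 (hz 0) _ (mem_interior_iff_mem_nhds.1 hzi)
  obtain ⟨n, -, hwn⟩ := mem_iUnion₂.1 hwU
  exact disjoint_left.1 (image_leaf_disjoint_Dlim hbi hι hK hdec n) hwn hw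

include hbi hι hK hdec in
/-- **The curves converge to the frontier of the limit set**: eventually every point of `ι(K n)` is
within `ε` of `frontier Dlim`. [folklore] -/
theorem eventually_forall_infDist_lt {ε : ℝ} (hε : 0 < ε) :
    ∀ᶠ n in atTop, ∀ z ∈ ι '' F.leaf (K n), Metric.infDist z (frontier (Dlim ι F K)) < ε := by
  rw [eventually_atTop]
  by_contra h
  push Not at h
  -- far points of arbitrarily late curves: a nested family of nonempty compact sets
  set S : ℕ → Set ℂ := fun N ↦ closure (⋃ n ≥ N, ι '' F.leaf (K n)) ∩ {z | ε ≤ Metric.infDist z (frontier (Dlim ι F K))} with hS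
  have hfarClosed : IsClosed {z : ℂ | ε ≤ Metric.infDist z (frontier (Dlim ι F K))} :=
    isClosed_le continuous_const (Metric.continuous_infDist_pt _)
  have hSclosed : ∀ N, IsClosed (S N) := fun N ↦ isClosed_closure.inter hfarClosed
  have hU0 : (⋃ n ≥ (0 : ℕ), ι '' F.leaf (K n)) ⊆ discLeaf F ι (K 0) :=
    iUnion₂_subset fun n hn ↦ image_leaf_subset_discLeaf_of_le hdec hn
  have hcl0 : closure (⋃ n ≥ (0 : ℕ), ι '' F.leaf (K n)) ⊆ discLeaf F ι (K 0) :=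
    (isClosed_discLeaf hbi hι (hK 0)).closure_subset_iff.2 hU0
  have hScpt : IsCompact (S 0) :=
    ((isCompact_discLeaf hbi hι (hK 0)).of_isClosed_subset isClosed_closure hcl0).inter_right hfarClosed
  have hSmono : ∀ N, S (N + 1) ⊆ S N := fun N ↦ by
    refine inter_subset_inter_left _ (closure_mono ?_)
    exact biUnion_subset_biUnion_left fun n (hn : N + 1 ≤ n) ↦ (Nat.le_of_succ_le hn : N ≤ n)
  have hSne : ∀ N, (S N).Nonempty := fun N ↦ by
    obtain ⟨n, hn, z, hz, hfar⟩ := h N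
    exact ⟨z, subset_closure (mem_biUnion hn hz), hfar⟩
  obtain ⟨z, hz⟩ := IsCompact.nonempty_iInter_of_sequence_nonempty_isCompact_isClosed S hSmono hSne hScpt hSclosed
  have hzfr : z ∈ frontier (Dlim ι F K) := mem_frontier_Dlim_of_clusterPt hbi hι hK hdec fun N ↦ (mem_iInter.1 hz N).1
  have hfar : ε ≤ Metric.infDist z (frontier (Dlim ι F K)) := (mem_iInter.1 hz 0).2
  rw [Metric.infDist_zero_of_mem hzfr] at hfar
  exact absurd hfar (not_le.2 hε)

end Literature.Topology.PlanarFoliations
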